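import Literature.AlgebraicGeometry.Resolution.PrimeDivisorIdeals
import Literature.AlgebraicGeometry.Resolution.MarkedIdealsLemmas
import Literature.AlgebraicGeometry.Resolution.BlowupChartMembership
import HarnessLib

/-!
# [OURS · L1 W4.5(b) · EL♮(3)] HSUB(ReachTC⁺) brick `inv_base`, part 1c: A CARTIER DIVISOR WITH PRESCRIBED GERM on a regular
# integral scheme — for `0 ≠ f ∈ 𝒪_{X,p}` a stalkwise principal ideal sheaf `K` with `K_p = (f)`

Crux chain w45b (cell `res-hironaka`, slot W4.5(b)), working crux **EL♮** = stmt-ResolutionOfSingularities-20038, child **EL♮(3)** =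
stmt-ResolutionOfSingularities-20148, route EquisingularLift, line `sections`, registered stub `stub_elnat_tcPlusPointResolution`;
assembly HSUB(ReachTC⁺)₃ of res-L1-w45b-stub-1 (INV DEFS v3, `TCPlus.Member` clause (iii) «`∀ z : X`, `K_z` principal»; brick `inv_base`
dealt to res-type-100 2026-08-27T11:31:42Z). HONEST FRAMING: OURS; NOT a statement of any manuscript; AI-written, weaker than expert
review. No `sorry`; standard axioms. `--supports stmt-ResolutionOfSingularities-20148 --as helper`. DEF-FREE.

WHY. The cone of the uncentred / centred members is needed only through its germ `Φ₀(c)` at the vertex `p` (part 1b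
`exists_coneGerm_of_admTC` quantifies over every ideal sheaf with that germ); choosing it as the Cartier divisor of this file makes it
stalkwise principal on ALL of `X'`, hence its strict transform stalkwise principal on all of `X₁` (res-D-pv-032
`isPrincipal_stalkIdeal_strictTransformIdeal`, p529806) — clause (iii) of `TCPlus.Member` verbatim.

WHAT.
* `exists_primeDivisorIdeal_stalkIdeal_eq_span` — for a prime element `π` of the (factorial) local ring `𝒪_{X,p}` of a regular
  integral locally Noetherian scheme there is a codimension-one point `ζ ⤳ p` with `(𝓘_{cl ζ})_p = (π)`; `𝓘_{cl ζ}` is stalkwise principal.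
* `exists_forall_isPrincipal_stalkIdeal_eq_span_prod` — the same for a product of primes (product of the prime divisor ideals).
* **`exists_forall_isPrincipal_stalkIdeal_eq_span`** — for every `f ≠ 0` in `𝒪_{X,p}`: an ideal sheaf `K` with `K_z` principal for all
  `z` and `K_p = (f)` (factor `f` in the UFD `𝒪_{X,p}`, Auslander–Buchsbaum, tree `Scheme.IsRegular.uniqueFactorizationMonoid_stalk`).

References: tree `PrimeDivisorIdeals` (Görtz–Wedhorn I, Thm. 11.40 (2); Matsumura Thm. 20.3), `StalkSpecializesLocalization`.
-/

set_option linter.dupNamespace false -- mandated namespace `Summit.<Summit>.<Problem>` of this single-conjunct summit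

noncomputable section

open CategoryTheory CategoryTheory.Limits AlgebraicGeometry TopologicalSpace IsLocalRing
open Literature.AlgebraicGeometry.Resolution

namespace Summit.ResolutionOfSingularities.ResolutionOfSingularities.Cruxes.EquisingularLiftNat.Sections

universe u

variable {X : Scheme.{u}} [IsIntegral X] [IsLocallyNoetherian X]

/-- **A prime divisor with prescribed prime germ.** `X` regular integral locally Noetherian, `p ∈ X`, `π ∈ 𝒪_{X,p}` prime: there is a
point `ζ ⤳ p` of codimension one whose prime divisor ideal `𝓘_{cl ζ}` has germ `(π)` at `p`; it is stalkwise principal everywhere.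
[cite: GortzWedhorn2020, Thm. 11.40 (2)] -/
theorem exists_primeDivisorIdeal_stalkIdeal_eq_span (hX : Scheme.IsRegular X) (p : X) {π : X.presheaf.stalk p} (hπ : Prime π) :
    ∃ K : X.IdealSheafData, (∀ z : X, (stalkIdeal K z).IsPrincipal) ∧ stalkIdeal K p = Ideal.span {π} := by
  haveI : (Ideal.span {π}).IsPrime := (Ideal.span_singleton_prime hπ.ne_zero).mpr hπ
  -- the generisation `ζ ⤳ p` with `𝔭_ζ = (π)`
  obtain ⟨ζ, hζ, hP⟩ := exists_specializes_comap_stalkSpecializes_eq p (Ideal.span {π})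
  have hPζ : primeOfSpecializes hζ = Ideal.span {π} := hP.symm
  -- `ζ` has codimension one: `ht (π) = 1`
  have hπ0 : π ∈ nonZeroDivisors (X.presheaf.stalk p) := mem_nonZeroDivisors_of_ne_zero hπ.ne_zero
  have h1 : (Ideal.span {π}).height = 1 := Ideal.height_span_singleton_eq_one_of_mem_nonZeroDivisors hπ0 hπ.not_unit
  have hcoh : Order.coheight ζ = 1 := by
    have h := coe_height_primeOfSpecializes hζ
    rw [hPζ, h1] at h
    exact_mod_cast h.symm
  refine ⟨primeDivisorIdeal ζ, fun z => ?_, by rw [stalkIdeal_primeDivisorIdeal hζ, hPζ]⟩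
  obtain ⟨g, -, hg⟩ :=
    IsEffectiveCartier.exists_stalkIdeal_eq_span (isEffectiveCartier_primeDivisorIdeal_of_isRegular hX hcoh) z
  exact ⟨⟨g, hg⟩⟩

/-- The product version: for a multiset of primes of `𝒪_{X,p}` there is a stalkwise principal ideal sheaf with germ `(∏ π)` at `p`
(the product of the prime divisor ideals). [cite: GortzWedhorn2020, Thm. 11.40 (2)] -/
theorem exists_forall_isPrincipal_stalkIdeal_eq_span_prod (hX : Scheme.IsRegular X) (p : X)
    (M : Multiset (X.presheaf.stalk p)) (hM : ∀ π ∈ M, Prime π) :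
    ∃ K : X.IdealSheafData, (∀ z : X, (stalkIdeal K z).IsPrincipal) ∧ stalkIdeal K p = Ideal.span {M.prod} := by
  induction M using Multiset.induction_on with
  | empty =>
    refine ⟨⊤, fun z => ⟨⟨1, by rw [stalkIdeal_top, Ideal.submodule_span_eq, Ideal.span_singleton_one]⟩⟩, ?_⟩
    rw [stalkIdeal_top, Multiset.prod_zero, Ideal.span_singleton_one]
  | cons π M ih =>
    obtain ⟨K₁, hK₁, hK₁p⟩ := exists_primeDivisorIdeal_stalkIdeal_eq_span hX p (hM π (Multiset.mem_cons_self π M))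
    obtain ⟨K₂, hK₂, hK₂p⟩ := ih fun π' hπ' => hM π' (Multiset.mem_cons_of_mem hπ')
    refine ⟨K₁ * K₂, fun z => ?_, ?_⟩
    · obtain ⟨a, ha⟩ := (hK₁ z).principal
      obtain ⟨b, hb⟩ := (hK₂ z).principal
      refine ⟨⟨a * b, ?_⟩⟩
      rw [stalkIdeal_mul, Ideal.submodule_span_eq, ← Ideal.span_singleton_mul_span_singleton]
      exact congrArg₂ (· * ·) ha hb
    · rw [stalkIdeal_mul, hK₁p, hK₂p, Ideal.span_singleton_mul_span_singleton, Multiset.prod_cons]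

/-- **A Cartier divisor with prescribed germ.** On a regular integral locally Noetherian scheme `X`, for every point `p` and every
non-zero germ `f ∈ 𝒪_{X,p}` there is an ideal sheaf `K` whose stalks are ALL principal and with `K_p = (f)`: factor `f` into primes in
the factorial ring `𝒪_{X,p}` (Auslander–Buchsbaum, tree `Scheme.IsRegular.uniqueFactorizationMonoid_stalk`) and take the product of the
prime divisor ideals of the corresponding codimension-one generisations of `p`. [cite: Matsumura1987, Thm. 20.3; GortzWedhorn2020, Thm. 11.40 (2)] -/
theorem exists_forall_isPrincipal_stalkIdeal_eq_span (hX : Scheme.IsRegular X) (p : X) {f : X.presheaf.stalk p} (hf : f ≠ 0) :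
    ∃ K : X.IdealSheafData, (∀ z : X, (stalkIdeal K z).IsPrincipal) ∧ stalkIdeal K p = Ideal.span {f} := by
  classical
  haveI : UniqueFactorizationMonoid (X.presheaf.stalk p) := hX.uniqueFactorizationMonoid_stalk p
  obtain ⟨K, hK, hKp⟩ := exists_forall_isPrincipal_stalkIdeal_eq_span_prod hX p (UniqueFactorizationMonoid.factors f)
    fun π hπ => UniqueFactorizationMonoid.prime_of_factor π hπ
  refine ⟨K, hK, ?_⟩
  rw [hKp]
  exact Ideal.span_singleton_eq_span_singleton.mpr (UniqueFactorizationMonoid.factors_prod hf)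

end Summit.ResolutionOfSingularities.ResolutionOfSingularities.Cruxes.EquisingularLiftNat.Sections

end
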